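import Mathlib
import Literature.NumberTheory.Transcendental.LandauDefectLatticeTate
import Literature.NumberTheory.Transcendental.AxDerivationTools
import Literature.NumberTheory.Transcendental.DerivationExtension
import Literature.RingTheory.PowerSeries.LaurentSeriesConstants

/-!
# Crux `InverseLandauRationalCurves`, line `Sketch` — kernel helpers, II: the derivation `d/dϖ`

Helpers for the lead's stub `stub_kernel` (item stmt-KontsevichZagierPeriods-13872):

* `exists_derivation_ratFunc` — `d/dϖ` on `k(ϖ)` as a `k`-derivation (`Dϖ = 1`,
  `D p = p′` on polynomials).
* `coe_derivation_ratFunc` — compatibility with `LaurentSeries.derivative` under `k(ϖ) ↪ k((ϖ))`.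
* `exists_derivation_extend` — extension to any field `K ⊇ k(ϖ)` of characteristic zero.
* `derivation_eq_smul_of_isAlgebraic` — on an ALGEBRAIC extension `K ⊇ k(ϖ)` every `k`-derivation
  is `δ(ϖ) · D` (uniqueness).
-/

noncomputable section

open Polynomial
open scoped LaurentSeries RatFunc
open Literature.NumberTheory.Transcendental

namespace Summit.KontsevichZagierPeriods.InverseLandau.RationalCurves

variable {k : Type*} [Field k]

/-- **`d/dϖ` on `k(ϖ)`**: a `k`-derivation `D₀` of `RatFunc k` with `D₀ ϖ = 1` and `D₀ p = p′` on
polynomials (extension of `Polynomial.derivative` to the fraction field). -/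
theorem exists_derivation_ratFunc :
    ∃ D₀ : Derivation k (RatFunc k) (RatFunc k), D₀ RatFunc.X = 1 ∧
      ∀ p : k[X], D₀ (algebraMap k[X] (RatFunc k) p) =
        algebraMap k[X] (RatFunc k) (derivative p) := by
  let d : Derivation k k[X] (RatFunc k) := Polynomial.mkDerivation k (1 : RatFunc k)
  have hd : ∀ p : k[X], d p = algebraMap k[X] (RatFunc k) (derivative p) := fun p => by
    change Polynomial.mkDerivation k (1 : RatFunc k) p = _
    rw [Polynomial.mkDerivation_apply, Algebra.smul_def, mul_one]
  obtain ⟨D₀, hD₀⟩ := exists_derivation_extend_of_isFractionRing (R := k) (A := k[X])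
    (K := RatFunc k) d
  refine ⟨D₀, ?_, fun p => by rw [hD₀, hd]⟩
  rw [← RatFunc.algebraMap_X, hD₀, hd, derivative_X, map_one]

/-- **Compatibility with the Laurent expansion**: `(D₀ x)^ = d/dϖ (x^)` in `k((ϖ))` for every
`x ∈ k(ϖ)` (two `k`-derivations `k(ϖ) → k((ϖ))` agreeing on `k[ϖ]`). -/
theorem coe_derivation_ratFunc (D₀ : Derivation k (RatFunc k) (RatFunc k))
    (hD₀ : ∀ p : k[X], D₀ (algebraMap k[X] (RatFunc k) p) =
      algebraMap k[X] (RatFunc k) (derivative p))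
    (x : RatFunc k) : ((D₀ x : RatFunc k) : k⸨X⸩) = LaurentSeries.derivative k (x : k⸨X⸩) := by
  obtain ⟨𝒟, h𝒟⟩ := Literature.RingTheory.PowerSeries.exists_derivation_eq_derivative (R := k)
  have hpoly : ∀ p : k[X], ((algebraMap k[X] (RatFunc k) p : RatFunc k) : k⸨X⸩) =
      ((p : PowerSeries k) : k⸨X⸩) := fun p => (RatFunc.coe_coe p).symm
  have h𝒟poly : ∀ p : k[X], 𝒟 ((algebraMap k[X] (RatFunc k) p : RatFunc k) : k⸨X⸩) =
      ((algebraMap k[X] (RatFunc k) (derivative p) : RatFunc k) : k⸨X⸩) := fun p => by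
    rw [h𝒟, hpoly, hpoly, Literature.RingTheory.PowerSeries.derivative_coe_polynomial]
  -- write `x = num / denom` and use the quotient rule on both sides
  set N : RatFunc k := algebraMap k[X] (RatFunc k) x.num with hN
  set Dn : RatFunc k := algebraMap k[X] (RatFunc k) x.denom with hDn
  have hx : x = N / Dn := (RatFunc.num_div_denom x).symm
  rw [hx, Derivation.leibniz_div, hN, hDn, hD₀, hD₀, ← h𝒟]
  change algebraMap (RatFunc k) k⸨X⸩ _ = 𝒟 (algebraMap (RatFunc k) k⸨X⸩ _)
  rw [map_div₀ (algebraMap (RatFunc k) k⸨X⸩) (algebraMap k[X] (RatFunc k) x.num),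
    Derivation.leibniz_div]
  simp only [map_mul, map_sub, map_pow, map_inv₀, smul_eq_mul, h𝒟poly]

section Extension

variable {K : Type*} [Field K] [Algebra k K] [Algebra (RatFunc k) K] [IsScalarTower k (RatFunc k) K]

/-- **Extension of `d/dϖ`** to any field `K ⊇ k(ϖ)` (characteristic zero). -/
theorem exists_derivation_extend [CharZero k] (D₀ : Derivation k (RatFunc k) (RatFunc k)) :
    ∃ D : Derivation k K K, ∀ x : RatFunc k,
      D (algebraMap (RatFunc k) K x) = algebraMap (RatFunc k) K (D₀ x) := by
  let d : Derivation k (RatFunc k) K := (Algebra.linearMap (RatFunc k) K).compDer D₀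
  obtain ⟨D, hD⟩ := Derivation.exists_extension_of_charZero (R := k) (F := RatFunc k) (T := K)
    (M := K) d
  exact ⟨D, fun x => by rw [hD]; rfl⟩

/-- The image of a polynomial in `ϖ` is `aeval ϖ`. -/
theorem algebraMap_algebraMap_polynomial (p : k[X]) :
    algebraMap (RatFunc k) K (algebraMap k[X] (RatFunc k) p) =
      aeval (algebraMap (RatFunc k) K RatFunc.X) p := by
  rw [← Polynomial.aeval_X_left_apply (R := k) p, ← Polynomial.aeval_algebraMap_apply,
    RatFunc.algebraMap_X, ← Polynomial.aeval_algebraMap_apply, Polynomial.aeval_X_left_apply]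

/-- **Uniqueness**: on an algebraic extension `K ⊇ k(ϖ)`, a `k`-derivation killing `ϖ` is zero. -/
theorem derivation_eq_zero_of_apply_X [CharZero k] [Algebra.IsAlgebraic (RatFunc k) K]
    (Δ : Derivation k K K) (hΔ : Δ (algebraMap (RatFunc k) K RatFunc.X) = 0) : Δ = 0 := by
  haveI : CharZero (RatFunc k) := inferInstance
  -- `Δ` vanishes on `k[ϖ]`
  have hpoly : ∀ p : k[X], Δ (algebraMap (RatFunc k) K (algebraMap k[X] (RatFunc k) p)) = 0 :=
    fun p => by rw [algebraMap_algebraMap_polynomial, Derivation.map_aeval, hΔ, smul_zero]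
  -- hence on `k(ϖ)`
  have hK₀ : ∀ x : RatFunc k, Δ (algebraMap (RatFunc k) K x) = 0 := by
    intro x
    have key : Δ.compAlgebraMap (RatFunc k) = 0 :=
      derivation_eq_of_isFractionRing (A := k[X]) (Δ.compAlgebraMap (RatFunc k)) 0
        fun p => by rw [Derivation.zero_apply]; exact hpoly p
    have := congrArg (fun D => D x) key
    simpa using this
  -- hence on `K`
  exact derivation_eq_zero_of_algebra_isAlgebraic (F := RatFunc k) Δ hK₀

/-- **Uniqueness, multiplicative form**: on an algebraic extension `K ⊇ k(ϖ)` with a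
`k`-derivation `D` normalised by `Dϖ = 1`, every `k`-derivation `δ` is `δ(ϖ) · D`. -/
theorem derivation_eq_smul [CharZero k] [Algebra.IsAlgebraic (RatFunc k) K]
    (D : Derivation k K K) (hD : D (algebraMap (RatFunc k) K RatFunc.X) = 1)
    (δ : Derivation k K K) (x : K) :
    δ x = δ (algebraMap (RatFunc k) K RatFunc.X) * D x := by
  have key := derivation_eq_zero_of_apply_X (k := k)
    (δ - δ (algebraMap (RatFunc k) K RatFunc.X) • D)
    (by rw [Derivation.sub_apply, Derivation.smul_apply, hD, smul_eq_mul, mul_one, sub_self])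
  have := congrArg (fun E => E x) key
  simp only [Derivation.sub_apply, Derivation.smul_apply, Derivation.zero_apply, smul_eq_mul,
    sub_eq_zero] at this
  exact this

/-- The extension `D` of `d/dϖ` restricted to `k(ϖ)` IS `d/dϖ`: `D x = (D₀ x)` whenever
`D ϖ = 1` (uniqueness on the fraction field `k(ϖ)` of `k[ϖ]`; note `D₀ ϖ = 1` is automatic,
`derivation_ratFunc_X`). -/
theorem derivation_algebraMap_eq [CharZero k] (D₀ : Derivation k (RatFunc k) (RatFunc k))
    (hD₀ : ∀ p : k[X], D₀ (algebraMap k[X] (RatFunc k) p) =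
      algebraMap k[X] (RatFunc k) (derivative p))
    (D : Derivation k K K) (hD : D (algebraMap (RatFunc k) K RatFunc.X) = 1) (x : RatFunc k) :
    D (algebraMap (RatFunc k) K x) = algebraMap (RatFunc k) K (D₀ x) := by
  let D₁ : Derivation k (RatFunc k) K := D.compAlgebraMap (RatFunc k)
  let D₂ : Derivation k (RatFunc k) K := (Algebra.linearMap (RatFunc k) K).compDer D₀
  have key : D₁ = D₂ := by
    refine derivation_eq_of_isFractionRing (A := k[X]) D₁ D₂ fun p => ?_
    change D (algebraMap (RatFunc k) K (algebraMap k[X] (RatFunc k) p)) =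
      algebraMap (RatFunc k) K (D₀ (algebraMap k[X] (RatFunc k) p))
    rw [hD₀, algebraMap_algebraMap_polynomial, Derivation.map_aeval, hD, smul_eq_mul, mul_one,
      algebraMap_algebraMap_polynomial]
  have := congrArg (fun E => E x) key
  exact this

omit [Algebra k K] [IsScalarTower k (RatFunc k) K] in
/-- `D₀ ϖ = 1` follows from the polynomial rule. -/
theorem derivation_ratFunc_X (D₀ : Derivation k (RatFunc k) (RatFunc k))
    (hD₀ : ∀ p : k[X], D₀ (algebraMap k[X] (RatFunc k) p) =
      algebraMap k[X] (RatFunc k) (derivative p)) : D₀ RatFunc.X = 1 := by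
  rw [← RatFunc.algebraMap_X, hD₀, derivative_X, map_one]

end Extension

/-- **Registered sub-goal `kernel_deriv_pack`** (packaging for the gate): `d/dϖ` on `k(ϖ)`,
compatible with the Laurent expansion, extends to any `K ⊇ k(ϖ)` with `Dϖ = 1`. -/
theorem kernel_deriv_pack : ∀ {k : Type*} [Field k] [CharZero k] {K : Type*} [Field K]
    [Algebra k K] [Algebra (RatFunc k) K] [IsScalarTower k (RatFunc k) K],
    ∃ (D₀ : Derivation k (RatFunc k) (RatFunc k)) (D : Derivation k K K),
      (∀ p : Polynomial k, D₀ (algebraMap (Polynomial k) (RatFunc k) p) =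
        algebraMap (Polynomial k) (RatFunc k) (Polynomial.derivative p)) ∧
      (∀ x : RatFunc k, ((D₀ x : RatFunc k) : LaurentSeries k) =
        LaurentSeries.derivative k (x : LaurentSeries k)) ∧
      (∀ x : RatFunc k, D (algebraMap (RatFunc k) K x) = algebraMap (RatFunc k) K (D₀ x)) ∧
      D (algebraMap (RatFunc k) K RatFunc.X) = 1 := by
  intro k _ _ K _ _ _ _
  obtain ⟨D₀, hX, hD₀⟩ := exists_derivation_ratFunc (k := k)
  obtain ⟨D, hD⟩ := exists_derivation_extend (K := K) D₀
  exact ⟨D₀, D, hD₀, coe_derivation_ratFunc D₀ hD₀, hD, by rw [hD, hX, map_one]⟩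

end Summit.KontsevichZagierPeriods.InverseLandau.RationalCurves

end
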